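import Summits.BirchSwinnertonDyer.BirchSwinnertonDyer.Theorems.Rank2ObservatoryThreeIsoSupport
import Summits.BirchSwinnertonDyer.BirchSwinnertonDyer.Theorems.Rank2ObservatoryThreeIsoLocalKill

/-!
# Rank-2 observatory, KERNEL-3ISO (B4-2): the `E`-side image bound from a certificate list

HONEST FRAMING: per-curve certified theorems and census instruments; no claim on BSD in rank ≥ 2.

Cell `bsd-rank2-observatory`, cert-1 leg KERNEL-3ISO, generation 10. The `E`-side of a row certificate
is DATA: the primes `p₁ < … < pₙ` of `2s` (support law A4 `ThreeIso.descent_value_mem`: every value of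
the `3`-descent map `κ` is `[∏ pᵢ^{vᵢ}]`, `v ∈ {0,1,2}ⁿ`) and a list of LOCAL-KILL CERTIFICATES
`((v, p, k), (g, l₁, l₂, l₃), (A, B, C, D))`: the class `u = ∏ pᵢ^{vᵢ}`, a prime power `p^k`, and the
`p`-minimised torsor `A X³ + B Y³ + C Z³ + D XYZ = (1/g) · F_u(l₁ X, l₂ Y, l₃ Z)`,
`F_u = u² X³ + Y³ + 2su Z³ - 2mu XYZ` (A5 `ThreeIso.descent_value_ne_of_kill`). A certificate is VALID when
`p` is prime, the bookkeeping identities hold in `ℤ`, and the three affine charts of the reduced cubic have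
no zero modulo `p^k` — a `decide`-able conjunction over `ℕ`/`ℤ` (`hvalid`, one `decide` per row).
**`descent_mem_of_certs`**: every value `κ(P)` then lies in the image of the exponent vectors `v` killed
by no certificate, neither directly nor through the inverse class `2v` (`κ(-P) = -κ(P)`,
`descent_value_ne_of_ne_inv`). The row reads `#S < 3^(a+1)` off this finite set by `decide`
(B4-0 `ThreeIso.mordellWeilRank_le_of_images_log`).

References: [Cohen2007NumberTheoryI] H. Cohen, GTM 239, Prop. 8.4.8, §8.4.5 (local solubility of the
torsors); [CohenPazuki2009] H. Cohen, F. Pazuki, Acta Arith. 140 (2009), Thm. 3.1.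
-/

set_option linter.dupNamespace false

noncomputable section

open scoped Classical

open WeierstrassCurve

namespace Summit.BirchSwinnertonDyer.BirchSwinnertonDyer.Rank2Observatory.ThreeIso

open Literature.NumberTheory.EllipticCurves Literature.NumberTheory.EllipticCurves.MordellDescent

/-- Inverse classes come for free: if `[u]` is not a value of an additive `κ` into `F*/F*³` and
`u u' = w³`, then `[u'] = [u]⁻¹` is not a value either (`κ(-P) = -κ(P)`). [folklore] -/
theorem descent_value_ne_of_ne_inv {A : Type*} [AddCommGroup A] {F : Type*} [Field F]
    (κ : A →+ Additive (CubeUnits F)) {u u' w : F} (hu : u ≠ 0) (hu' : u' ≠ 0) (hw : u * u' = w ^ 3)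
    (hne : ∀ P, κ P ≠ Additive.ofMul (cubeClass u)) (P : A) :
    κ P ≠ Additive.ofMul (cubeClass u') := by
  intro hP
  apply hne (-P)
  rw [map_neg, hP, ← ofMul_inv, cubeClass_eq_mul_self_of_mul_eq_cube hu hu' hw]
  congr 1
  exact inv_eq_of_mul_eq_one_right (CubeUnits.mul_mul_self _)

/-- In `Fin 3`: `q^{2v} · q^{v}` is a cube (`v + v` is the inverse exponent). [folklore] -/
theorem pow_add_self_mul_pow_eq_cube {M : Type*} [CommMonoid M] (q : M) (x : Fin 3) :
    q ^ ((x + x : Fin 3) : ℕ) * q ^ (x : ℕ) = (q ^ (if x = 0 then 0 else 1)) ^ 3 := by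
  fin_cases x
  · simp
  · show q ^ 2 * q ^ 1 = (q ^ 1) ^ 3; rw [← pow_add, ← pow_mul]
  · show q ^ 1 * q ^ 2 = (q ^ 1) ^ 3; rw [← pow_add, ← pow_mul]

/-- In `Fin 3`, conjugate exponents `(3 - v) mod 3`: `q̄^{(3-2v) mod 3} · q̄^{(3-v) mod 3}` is a cube.
[folklore] -/
theorem pow_sub_add_self_mul_pow_sub_eq_cube {M : Type*} [CommMonoid M] (q : M) (x : Fin 3) :
    q ^ ((3 - ((x + x : Fin 3) : ℕ)) % 3) * q ^ ((3 - (x : ℕ)) % 3) =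
      (q ^ (if x = 0 then 0 else 1)) ^ 3 := by
  fin_cases x
  · simp
  · show q ^ 1 * q ^ 2 = (q ^ 1) ^ 3; rw [← pow_add, ← pow_mul]
  · show q ^ 2 * q ^ 1 = (q ^ 1) ^ 3; rw [← pow_add, ← pow_mul]

/-- **`E`-side image bound from a certificate list** (A4 support law + A5 local kills, read from
validated data). For `E_{m,s}` (`m, s ∈ ℤ`) with the primes of `2s` enumerated injectively by
`ps : Fin n → ℕ` and a list of valid local-kill certificates, every value of a `3`-descent map `κ` is
`[∏ pᵢ^{vᵢ}]` for an exponent vector `v` which no certificate kills directly or through `2v`.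
[cite: Cohen2007NumberTheoryI, Prop. 8.4.8; CohenPazuki2009, Thm. 3.1] -/
theorem descent_mem_of_certs {W W' : WeierstrassCurve ℚ} {m s : ℤ}
    (h : IsVeluThreePair (m : ℚ) (s : ℚ) W W')
    (κ : W.toAffine.Point →+ Additive (CubeUnits ℚ))
    (hκ : ∀ (x y : ℚ) (hP : W.toAffine.Nonsingular x y), κ (.some x y hP) =
      Additive.ofMul (cubeClass (if y = m * x + s then (2 * (s : ℚ)) ^ 2 else y - (m * x + s))))
    {n : ℕ} (ps : Fin n → ℕ) (hps : (2 * s).natAbs.primeFactors = Finset.univ.image ps)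
    (hinj : Function.Injective ps)
    (certs : List (((Fin n → Fin 3) × ℕ × ℕ) × (ℕ × ℕ × ℕ × ℕ) × (ℤ × ℤ × ℤ × ℤ)))
    (hvalid : ∀ c ∈ certs,
      c.1.2.1.Prime ∧ 0 < c.2.1.1 ∧ 0 < c.2.1.2.1 ∧ 0 < c.2.1.2.2.1 ∧ 0 < c.2.1.2.2.2 ∧
      c.2.2.1 * c.2.1.1 = ((∏ i, ps i ^ (c.1.1 i : ℕ) : ℕ) : ℤ) ^ 2 * c.2.1.2.1 ^ 3 ∧
      c.2.2.2.1 * c.2.1.1 = (c.2.1.2.2.1 : ℤ) ^ 3 ∧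
      c.2.2.2.2.1 * c.2.1.1 = 2 * s * ((∏ i, ps i ^ (c.1.1 i : ℕ) : ℕ) : ℤ) * c.2.1.2.2.2 ^ 3 ∧
      c.2.2.2.2.2 * c.2.1.1 =
        -(2 * m * ((∏ i, ps i ^ (c.1.1 i : ℕ) : ℕ) : ℤ) * (c.2.1.2.1 * c.2.1.2.2.1 * c.2.1.2.2.2)) ∧
      (∀ b : ℕ, b < c.1.2.1 ^ c.1.2.2 → ∀ d : ℕ, d < c.1.2.1 ^ c.1.2.2 →
        (c.2.2.1 + c.2.2.2.1 * (b : ℤ) ^ 3 + c.2.2.2.2.1 * (d : ℤ) ^ 3 + c.2.2.2.2.2 * (b * d))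
          % ((c.1.2.1 ^ c.1.2.2 : ℕ) : ℤ) ≠ 0) ∧
      (∀ a : ℕ, a < c.1.2.1 ^ c.1.2.2 → ∀ d : ℕ, d < c.1.2.1 ^ c.1.2.2 →
        (c.2.2.1 * (a : ℤ) ^ 3 + c.2.2.2.1 + c.2.2.2.2.1 * (d : ℤ) ^ 3 + c.2.2.2.2.2 * (a * d))
          % ((c.1.2.1 ^ c.1.2.2 : ℕ) : ℤ) ≠ 0) ∧
      (∀ a : ℕ, a < c.1.2.1 ^ c.1.2.2 → ∀ b : ℕ, b < c.1.2.1 ^ c.1.2.2 →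
        (c.2.2.1 * (a : ℤ) ^ 3 + c.2.2.2.1 * (b : ℤ) ^ 3 + c.2.2.2.2.1 + c.2.2.2.2.2 * (a * b))
          % ((c.1.2.1 ^ c.1.2.2 : ℕ) : ℤ) ≠ 0))
    (P : W.toAffine.Point) :
    κ P ∈ ((Finset.univ : Finset (Fin n → Fin 3)).filter
        (fun v => ∀ c ∈ certs, c.1.1 ≠ v ∧ c.1.1 ≠ v + v)).image
      (fun v => Additive.ofMul (cubeClass (∏ i, (ps i : ℚ) ^ (v i : ℕ)))) := by
  -- every `ps i` is a prime
  have hprime : ∀ i, (ps i).Prime := fun i =>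
    Nat.prime_of_mem_primeFactors (hps ▸ Finset.mem_image_of_mem ps (Finset.mem_univ i))
  have hune : ∀ v : Fin n → Fin 3, ((∏ i, ps i ^ (v i : ℕ) : ℕ) : ℚ) ≠ 0 := fun v => by
    exact_mod_cast Finset.prod_ne_zero_iff.mpr fun i _ => pow_ne_zero _ (hprime i).ne_zero
  have hcast : ∀ v : Fin n → Fin 3, ((∏ i, ps i ^ (v i : ℕ) : ℕ) : ℚ) = ∏ i, (ps i : ℚ) ^ (v i : ℕ) :=
    fun v => by push_cast; rfl
  -- the class of `P` (support law A4)
  obtain ⟨e, he3, heP⟩ := descent_value_mem h κ hκ P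
  set v : Fin n → Fin 3 := fun i => ⟨e (ps i), he3 _⟩ with hv
  have hprod : (∏ p ∈ (2 * s).natAbs.primeFactors, (p : ℚ) ^ e p) = ∏ i, (ps i : ℚ) ^ (v i : ℕ) := by
    rw [hps, Finset.prod_image fun i _ j _ hij => hinj hij]
  have hvP : κ P = Additive.ofMul (cubeClass (∏ i, (ps i : ℚ) ^ (v i : ℕ))) := by rw [heP, hprod]
  refine Finset.mem_image.mpr ⟨v, Finset.mem_filter.mpr ⟨Finset.mem_univ _, fun c hc => ?_⟩, hvP.symm⟩
  -- a valid certificate `c` kills its class `u` … (A5)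
  obtain ⟨hp, hg, hl₁, hl₂, hl₃, hA, hB, hC, hD, hk₁, hk₂, hk₃⟩ := hvalid c hc
  haveI : Fact c.1.2.1.Prime := ⟨hp⟩
  haveI : NeZero (c.1.2.1 ^ c.1.2.2) := ⟨pow_ne_zero _ hp.ne_zero⟩
  set u : ℕ := ∏ i, ps i ^ (c.1.1 i : ℕ) with hu
  have hu0 : (u : ℤ) ≠ 0 := by
    have := hune c.1.1; exact_mod_cast this
  have hgQ : (c.2.1.1 : ℚ) ≠ 0 := by exact_mod_cast hg.ne'
  have hkill : ∀ P, κ P ≠ Additive.ofMul (cubeClass ((u : ℤ) : ℚ)) := by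
    refine descent_value_ne_of_kill h κ hκ hu0 (c := 1 / (c.2.1.1 : ℚ)) (l₁ := c.2.1.2.1)
      (l₂ := c.2.1.2.2.1) (l₃ := c.2.1.2.2.2) (A := c.2.2.1) (B := c.2.2.2.1) (C := c.2.2.2.2.1)
      (D := c.2.2.2.2.2) (by exact_mod_cast hl₁.ne') (by exact_mod_cast hl₂.ne')
      (by exact_mod_cast hl₃.ne') ?_ ?_ ?_ ?_ (p := c.1.2.1) (k := c.1.2.2) ?_ ?_ ?_
    · field_simp; exact_mod_cast hA
    · field_simp; exact_mod_cast hB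
    · field_simp; exact_mod_cast hC
    · field_simp
      rw [← Int.cast_inj (α := ℚ)] at hD
      push_cast at hD
      linear_combination hD
    · intro b d hbd
      refine hk₁ b.val (ZMod.val_lt b) d.val (ZMod.val_lt d) (Int.emod_eq_zero_of_dvd ?_)
      refine (ZMod.intCast_zmod_eq_zero_iff_dvd _ _).mp ?_
      push_cast
      rw [ZMod.natCast_zmod_val, ZMod.natCast_zmod_val]
      linear_combination hbd
    · intro a d had
      refine hk₂ a.val (ZMod.val_lt a) d.val (ZMod.val_lt d) (Int.emod_eq_zero_of_dvd ?_)
      refine (ZMod.intCast_zmod_eq_zero_iff_dvd _ _).mp ?_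
      push_cast
      rw [ZMod.natCast_zmod_val, ZMod.natCast_zmod_val]
      linear_combination had
    · intro a b hab
      refine hk₃ a.val (ZMod.val_lt a) b.val (ZMod.val_lt b) (Int.emod_eq_zero_of_dvd ?_)
      refine (ZMod.intCast_zmod_eq_zero_iff_dvd _ _).mp ?_
      push_cast
      rw [ZMod.natCast_zmod_val, ZMod.natCast_zmod_val]
      linear_combination hab
  have hkill' : ∀ P, κ P ≠ Additive.ofMul (cubeClass (∏ i, (ps i : ℚ) ^ (c.1.1 i : ℕ))) := by
    rw [← hcast]; exact_mod_cast hkill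
  -- … and the inverse class `2 c.v`
  refine ⟨fun hcv => hkill' P (hcv ▸ hvP), fun hcv => ?_⟩
  refine descent_value_ne_of_ne_inv κ (w := ∏ i, (ps i : ℚ) ^ (if v i = 0 then 0 else 1))
    (hcast c.1.1 ▸ hune c.1.1) (hcast v ▸ hune v) ?_ hkill' P hvP
  rw [hcv, ← Finset.prod_mul_distrib, ← Finset.prod_pow]
  exact Finset.prod_congr rfl fun i _ => pow_add_self_mul_pow_eq_cube _ (v i)

end Summit.BirchSwinnertonDyer.BirchSwinnertonDyer.Rank2Observatory.ThreeIso

end
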